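import Summits.CriticalPhenomena.PercolationContinuityZ3.Theorems.PercNearOneGluingNoHeavyLowerTailQ7PsiSetObserverGluedQ9
import Summits.CriticalPhenomena.PercolationContinuityZ3.Theorems.PercNearOneGluingNoHeavyLowerTailHullPortTANSetMarkerDominance
import HarnessLib

/-!
# `NoHeavyLowerTail` (stmt-CriticalPhenomena-4575) — Kozma–Nitzan's Question 9 at three relays, UNCONDITIONALLY

Support file (prover `prim-hp-7`; `--supports stmt-CriticalPhenomena-4575`); no definitions, named facts or sorries.
The coupling seat's chain (`prim-cplus-coupling` gen 13, memo A5-COUPLING-gen13.md; tree: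
`Q7Psi.gluedPreFKG_three_of_setMDL_allWeights`, …Q7PsiSetObserverGluedQ9.lean) reduces Kozma–Nitzan's Question 9
(arXiv:2401.12397, p. 36) at `|A| = 3`, in its glued form "(41) in `H/N` with designation in `H`", to ONE schema hypothesis: the
set-observer marker dominance lemma at non-degenerate weights.  That schema is prim-hp-7's `HullPort.setMarkerDominance_hcov`
(…HullPortTANSetMarkerDominance.lean; `T_A` induction for a set of observers, blueprint B2–B4).  This file plugs one into the other:
* `HullPort.kn_question9_three` — for every finite weighted graph, every observer SET `N ∌ b`, and distinct relays `x, y, z ≠ b`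
  with `μ(z ↔ b) ≤ μ(x ↔ b), μ(y ↔ b)` (designation in the graph itself = in `G` with the observer's edges removed, the
  observer being the glued set):
  `μ(({z ↔ b} ∪ ({N ↔ z} ∩ {N ↔ b})) ∩ {N ↔ {x,y,z}}) ≤ μ({N ↔ b} ∩ {N ↔ {x,y,z}})`,
  i.e. Kozma–Nitzan's (41) in `G/N` for the `G`-minimiser — Question 9 at three relays, for all weights and all observer sets.
No hypothesis remains.  (Literal star-by-star rewording to the printed Question 9: coupling seat, routine.)
[cite: KozmaNitzan2024, Question 9 (p. 36), §5.1 (pp. 31–32), Lemma 5 (p. 13)]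
[cite: VandenbergHaggstromKahn2005, Thms 1.3–1.5 (pp. 6–7), §2.1 pp. 9–13] [cite: Gladkov2024, Thm. 3.2]
-/

namespace Summit.CriticalPhenomena.PercolationContinuityZ3.Theorems

open MeasureTheory Set Literature.Probability.LatticeModels Literature.Probability.Percolation
open scoped Classical
open KNPreFKG

noncomputable section

namespace HullPort

universe u

variable {V : Type u} [Fintype V]

/-- **Kozma–Nitzan's Question 9 at three relays (glued form), unconditionally.**  Finite weighted graph `μ = prodBernoulli w`,
observer set `N ∌ b`, distinct relays `x, y, z ≠ b` with `μ(z↔b) ≤ μ(x↔b)` and `μ(z↔b) ≤ μ(y↔b)`; `N ↔ v := ∃ n ∈ N, n ↔ v`: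
`μ(({z↔b} ∪ ({N↔z} ∩ {N↔b})) ∩ ⋃_{a ∈ {x,y,z}} {N↔a}) ≤ μ({N↔b} ∩ ⋃_{a ∈ {x,y,z}} {N↔a})` — the pre-FKG inequality (41) in
`G/N` with the designation read in `G`.  `Q7Psi.gluedPreFKG_three_of_setMDL_allWeights` (coupling seat) fed with
`HullPort.setMarkerDominance_hcov` (prim-hp-7). [cite: KozmaNitzan2024, Question 9 (p. 36)] -/
theorem kn_question9_three (w : Sym2 V → unitInterval) (N : Set V) (b x y z : V) (hbN : b ∉ N)
    (hxb : x ≠ b) (hyb : y ≠ b) (hzb : z ≠ b) (hxy : x ≠ y) (hxz : x ≠ z) (hyz : y ≠ z)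
    (hzx : (prodBernoulli w).real (openConn z b) ≤ (prodBernoulli w).real (openConn x b))
    (hzy : (prodBernoulli w).real (openConn z b) ≤ (prodBernoulli w).real (openConn y b)) :
    (prodBernoulli w).real ((openConn z b ∪ ({ω : BondConfig V | ∃ n ∈ N, (openGraph ω).Reachable n z} ∩
        {ω : BondConfig V | ∃ n ∈ N, (openGraph ω).Reachable n b})) ∩
        ⋃ a ∈ ({x, y, z} : Finset V), {ω : BondConfig V | ∃ n ∈ N, (openGraph ω).Reachable n a}) ≤
      (prodBernoulli w).real ({ω : BondConfig V | ∃ n ∈ N, (openGraph ω).Reachable n b} ∩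
        ⋃ a ∈ ({x, y, z} : Finset V), {ω : BondConfig V | ∃ n ∈ N, (openGraph ω).Reachable n a}) :=
  Q7Psi.gluedPreFKG_three_of_setMDL_allWeights
    (fun _ _ p _ x' y' z' N' hxy' _ _ G hG => setMarkerDominance_hcov p x' y' z' N' hxy' G hG)
    w N b x y z hbN hxb hyb hzb hxy hxz hyz hzx hzy

end HullPort

end

end Summit.CriticalPhenomena.PercolationContinuityZ3.Theorems
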